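import Literature.Analysis.FluidPDE.FracNSEnergy
import Literature.Analysis.FluidPDE.FractionalNSReynoldsInitial
import Literature.Analysis.FluidPDE.FractionalNSPrescribedEnergyProlongationProofs
import HarnessLib

/-!
# De Rosa's gluing stage, §5.2: the glued triple `(v̄_q, p̄_q, R̊̄_q)` and its fractional
# Navier–Stokes–Reynolds system

L. De Rosa, *Infinitely many Leray–Hopf solutions for the fractional Navier–Stokes equations*,
Comm. PDE 44 (2019) 335–365 = arXiv:1801.10235, §5.2 ("Gluing step", pp. 11–14): for
`tᵢ = iτ_q` let `vᵢ` be the smooth solution of the fractional Navier–Stokes equations (5.9)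
`∂ₜvᵢ + div(vᵢ ⊗ vᵢ) + ∇pᵢ + ν(-Δ)^γ vᵢ = 0`, `div vᵢ = 0`, `vᵢ(·,tᵢ) = v_ℓ(·,tᵢ)`, considered for
`0 ≤ t - tᵢ ≤ 2τ_q` ("our stability estimates for smooth solutions of the fractional Navier–Stokes
equations hold for `0 ≤ t - tᵢ ≤ τ_q` as opposed to `|t - tᵢ| ≤ τ_q` in [BDLSV2017]"); with a
partition of unity `χᵢ` in time (`∑χᵢ = 1`, `supp χᵢ ⊂ I_{i-1} ∪ Jᵢ ∪ Iᵢ`, `χᵢ = 1` on `Jᵢ`,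
`‖∂ₜᴺχᵢ‖₀ ≲ τ_q^{-N}`, `Iᵢ = [t_{i+1} + τ_q/3, t_{i+1} + 2τ_q/3]`) set `v̄_q = ∑χᵢvᵢ`,
`p̄_q⁽¹⁾ = ∑χᵢpᵢ`, and on `Iᵢ`: `R̊̄_q = ∂ₜχᵢ ℛ(vᵢ - vᵢ₊₁) - χᵢ(1-χᵢ)(vᵢ - vᵢ₊₁) ⊗̊ (vᵢ - vᵢ₊₁)`,
`p̄_q⁽²⁾ = -χᵢ(1-χᵢ)(|vᵢ - vᵢ₊₁|² - ∫|vᵢ - vᵢ₊₁|²)`, `p̄_q = p̄⁽¹⁾ + p̄⁽²⁾`. "It follows from the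
preceding discussion and the definition of the operator `ℛ` that `R̊̄_q` is a smooth symmetric and
traceless 2-tensor; for all `(x,t) ∈ 𝕋³ × [0,T]`,
`∂ₜv̄_q + div(v̄_q ⊗ v̄_q) + ∇p̄_q + ν(-Δ)^γ v̄_q = div R̊̄_q`, `div v̄_q = 0`;
`supp R̊̄_q ⊂ 𝕋³ × ⋃ᵢ Iᵢ`" (pp. 13–14).

This file carries this out **with the glued fields of the BDSV files** (`BDSV.gluedVel`,
`BDSV.gluedPres`, `BDSV.gluedStress` of `OnsagerBDSVGluedTriple.lean`, the cut-offs
`BDSV.glueCutoff` of `OnsagerBDSVCutoffs.lean`): De Rosa's partition is BDSV's shifted by one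
index (his `χᵢ`, `i ≥ 1`, has plateau `Jᵢ ∋ t_{i+1}`, so it is BDSV's `χ_{i+1}`, and his `χ₀` is
BDSV's `χ₀ + χ₁`), hence feeding BDSV's formulas the family `u_j := v_{j-1}` (`u₀ := v₀`) — the
exact solution living on BDSV's `j`-th life span `S_j = [jτ - τ, jτ + τ] ∩ [0,T] = [t_{j-1}, t_{j-1} + 2τ]`
but **anchored at its left endpoint** `max(jτ - τ, 0)` — produces exactly De Rosa's
`(v̄_q, p̄_q, R̊̄_q)`, with stress supported in `⋃ⱼ [jτ + τ/3, jτ + 2τ/3]`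
(`BDSV.SupportedOnGlueIntervals`, the predicate of `DeRosa.gluingStage`). Accordingly:

* `DeRosa.IsGlueFamily γ ν T τ n v_ℓ p_ℓ R̊_ℓ u p` — the data of §5.2: a smooth solution
  `(v_ℓ, p_ℓ, R̊_ℓ)` of the fractional NSR system on `[0,T]` (`Torus.IsFracNSReynoldsOn`, §5.1) and,
  for every `j` with `jτ ≤ T`, a smooth exact solution `(u_j, p_j)` of the fractional
  Navier–Stokes equations on `S_j` with `u_j = v_ℓ` at the left endpoint of `S_j` ((5.9));
* `DeRosa.IsGlueFamily.grid` — the time grid (`T, τ, n`) is that of a BDSV glue family (of the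
  zero solution), whence all cut-off bookkeeping of `OnsagerBDSVGluedTriple.lean`;
* `Torus.IsFracNSReynoldsOn.integral_velocity_eq` — smooth solutions of the fractional NSR system
  conserve momentum (`∫(-Δ)^γ v = 0`, `Torus.integral_fracLaplacian_eq_zero`), whence
  `∫(u_j - u_{j+1}) = 0` (`DeRosa.IsGlueFamily.integral_velDiff`) and `div ℛ(u_j - u_{j+1}) = u_j - u_{j+1}`;
* `DeRosa.IsGlueFamily.isFracNSReynoldsOn_glued` — **the glued triple solves the fractional NSR
  system on `[0,T] × 𝕋³`** (the momentum balance of p. 13 with the extra linear term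
  `ν(-Δ)^γ v̄_q = χᵢ ν(-Δ)^γ vᵢ + (1-χᵢ) ν(-Δ)^γ vᵢ₊₁` on `Iᵢ`);
* `DeRosa.IsGlueFamily.supportedOnGlueIntervals_gluedStress` — `supp R̊̄_q ⊂ 𝕋³ × ⋃ Iᵢ`;
* `DeRosa.IsGlueFamily.gluedVel_zero` — `v̄_q(·,0) = v_ℓ(·,0)` (`χ₀ = 1` near `0`, `u₀(0) = v_ℓ(0)`),
  the time-zero clause of `DeRosa.gluingStage`.

As in the BDSV file, the printed `p̄⁽²⁾ = -χᵢ(1-χᵢ)(|vᵢ - vᵢ₊₁|² - ∫|vᵢ - vᵢ₊₁|²)` is replaced by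
the value `+χᵢ(1-χᵢ)(|vᵢ - vᵢ₊₁|²/3 - ∫|vᵢ - vᵢ₊₁|²/3)` forced by the momentum balance with the
conventions `div(v ⊗ v)`, `f ⊗̊ f = f ⊗ f - |f|²Id/3` (the pressure plays no role in Prop. 5.5).

On the duplication with `OnsagerBDSVGluedTriple.lean`: the grid lemmas, the local formulas
(`gluedVel_apply`, `gluedStress_apply`, `gluedPres_apply`, `timeDerivWithin_gluedVel`) and the
smoothness lemmas have the same statements as their `BDSV.IsGlueFamily` twins, but those take the
BDSV family (exact *Euler* solutions, `BDSV.IsExactEulerOn`) as hypothesis and cannot be applied to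
exact solutions of the fractional Navier–Stokes equations; here they are restated for
`DeRosa.IsGlueFamily`, the family-independent ones being one-line transports through
`DeRosa.IsGlueFamily.grid`, the others having the BDSV proofs with `Torus.IsFracNSReynoldsOn` in
place of `Torus.IsEulerReynoldsOn`. What is new is the fractional system of the glued triple
(`momentum`, with `ν(-Δ)^γ` and the conservation of momentum of fractional NSR solutions) and the
time-zero identity.

## References

* L. De Rosa, Comm. PDE 44 (2019) 335–365 = arXiv:1801.10235, §5.2: (5.9), the partition of
  unity `χᵢ`, `Iᵢ`, `Jᵢ`, the definitions of `v̄_q`, `p̄_q⁽¹⁾`, `p̄_q⁽²⁾`, `R̊̄_q`, the three bullets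
  (pp. 12–14). [`Derosa2018`]
* T. Buckmaster, C. De Lellis, L. Székelyhidi Jr., V. Vicol, CPAM 72 (2019) = arXiv:1701.08678,
  §4.1–4.2 (Prop. 4.1). [`BuckmasterEtAl2018`]
* C. De Lellis, L. Székelyhidi Jr., Invent. Math. 193 (2013), §4 (the operator `ℛ`).
-/

noncomputable section

open MeasureTheory Set Filter Topology Function
open scoped ContDiff

namespace Literature.Analysis.FluidPDE

/-! ## Conservation of momentum for the fractional Navier–Stokes–Reynolds system -/

namespace Torus

open FunctionSpaces FunctionSpaces.Torus

variable {d : Type*} [Fintype d] [DecidableEq d]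

/-- **Smooth solutions of the fractional NSR system conserve momentum**: `∫ v(s) = ∫ v(t)` for
`s, t ∈ [a,b]` when `γ > 0` (`d/dt ∫ v = ∫ (div R̊ - ∇p - (v·∇)v - ν(-Δ)^γ v) = 0`: each term
integrates to zero on the torus, the dissipative one because `(-Δ)^γ v` has vanishing zeroth
Fourier mode, `Torus.integral_fracLaplacian_eq_zero`; De Rosa (5.22): `curl z_i = v_i - ∫ v_i`).
[cite: Derosa2018, §5.2 (5.22)] -/
theorem IsFracNSReynoldsOn.integral_velocity_eq {a b γ ν : ℝ} {v : ℝ → UnitAddTorus d → EuclideanSpace ℝ d}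
    {p : ℝ → UnitAddTorus d → ℝ} {R : ℝ → UnitAddTorus d → d → EuclideanSpace ℝ d}
    (h : IsFracNSReynoldsOn (Icc a b) γ ν v p R) (hγ : 0 < γ) {s t : ℝ} (hs : s ∈ Icc a b) (ht : t ∈ Icc a b) :
    ∫ x, v s x = ∫ x, v t x := by
  rcases lt_or_ge a b with hab | hab
  · set E : ℝ → EuclideanSpace ℝ d := fun τ => ∫ x, v τ x with hE
    have hU : UniqueDiffOn ℝ (Icc a b) := uniqueDiffOn_Icc hab
    have hderiv : ∀ τ ∈ Icc a b, HasDerivWithinAt E (0 : EuclideanSpace ℝ d) (Icc a b) τ := by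
      intro τ hτ
      have h1 := h.smooth_velocity.hasDerivWithinAt_integral (convex_Icc a b) hτ
      have hvs : FunctionSpaces.Torus.IsSmooth (v τ) := h.smooth_velocity.isSmooth_slice hτ
      have hps : FunctionSpaces.Torus.IsSmooth (p τ) := h.smooth_pressure.isSmooth_slice hτ
      have hRs : FunctionSpaces.Torus.IsSmooth (R τ) := h.smooth_stress.isSmooth_slice hτ
      have h0 : ∫ x, FunctionSpaces.Torus.timeDerivWithin (Icc a b) v τ x = 0 := by
        have e : ∀ x, FunctionSpaces.Torus.timeDerivWithin (Icc a b) v τ x =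
            tensorDivergence (R τ) x - FunctionSpaces.Torus.gradient (p τ) x -
              FunctionSpaces.Torus.convect (v τ) (v τ) x - ν • fracLaplacian γ (v τ) x := by
          intro x
          rw [← h.momentum τ hτ x]
          abel
        simp_rw [e]
        have i1 : Integrable (fun x => tensorDivergence (R τ) x) volume := hRs.tensorDivergence.integrable
        have i2 : Integrable (fun x => FunctionSpaces.Torus.gradient (p τ) x) volume := hps.gradient.integrable
        have i3 : Integrable (fun x => FunctionSpaces.Torus.convect (v τ) (v τ) x) volume := (hvs.convect hvs).integrable
        have i4 : Integrable (fun x => ν • fracLaplacian γ (v τ) x) volume :=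
          (integrable_fracLaplacian hγ.le hvs).smul ν
        have i12 : Integrable (fun x => tensorDivergence (R τ) x - FunctionSpaces.Torus.gradient (p τ) x) volume := i1.sub i2
        have i123 : Integrable (fun x => tensorDivergence (R τ) x - FunctionSpaces.Torus.gradient (p τ) x -
            FunctionSpaces.Torus.convect (v τ) (v τ) x) volume := i12.sub i3
        have hc : ∫ x, FunctionSpaces.Torus.convect (v τ) (v τ) x = 0 :=
          integral_fderiv_apply_eq_zero_of_isDivFree hvs hvs (h.divFree τ hτ)
        have hL : ∫ x, ν • fracLaplacian γ (v τ) x = 0 := by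
          rw [integral_smul, integral_fracLaplacian_eq_zero hγ hvs, smul_zero]
        calc ∫ x, (tensorDivergence (R τ) x - FunctionSpaces.Torus.gradient (p τ) x -
              FunctionSpaces.Torus.convect (v τ) (v τ) x - ν • fracLaplacian γ (v τ) x)
            = (∫ x, (tensorDivergence (R τ) x - FunctionSpaces.Torus.gradient (p τ) x -
                FunctionSpaces.Torus.convect (v τ) (v τ) x)) - ∫ x, ν • fracLaplacian γ (v τ) x := integral_sub i123 i4
          _ = ((∫ x, (tensorDivergence (R τ) x - FunctionSpaces.Torus.gradient (p τ) x)) -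
                ∫ x, FunctionSpaces.Torus.convect (v τ) (v τ) x) - ∫ x, ν • fracLaplacian γ (v τ) x := by
              rw [integral_sub i12 i3]
          _ = (((∫ x, tensorDivergence (R τ) x) - ∫ x, FunctionSpaces.Torus.gradient (p τ) x) -
                ∫ x, FunctionSpaces.Torus.convect (v τ) (v τ) x) - ∫ x, ν • fracLaplacian γ (v τ) x := by
              rw [integral_sub i1 i2]
          _ = 0 := by rw [integral_tensorDivergence hRs, integral_gradient_eq_zero hps, hc, hL]; simp
      rw [h0] at h1
      exact h1
    have hdiff : DifferentiableOn ℝ E (Icc a b) := fun τ hτ => (hderiv τ hτ).differentiableWithinAt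
    have hconst := constant_of_derivWithin_zero hdiff fun τ hτ =>
      (hderiv τ (Ico_subset_Icc_self hτ)).derivWithin (hU τ (Ico_subset_Icc_self hτ))
    rw [show (∫ x, v s x) = E s from rfl, show (∫ x, v t x) = E t from rfl, hconst s hs, hconst t ht]
  · have hs' : s = a := le_antisymm (hs.2.trans hab) hs.1
    have ht' : t = a := le_antisymm (ht.2.trans hab) ht.1
    rw [hs', ht']

end Torus

namespace DeRosa

open FunctionSpaces FunctionSpaces.Torus
open BDSV hiding IsGlueFamily

/-- The flat three-torus `𝕋³ = (ℝ/ℤ)³`, local notation. -/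
local notation "𝕋³" => UnitAddTorus (Fin 3)

/-- Euclidean `ℝ³`, local notation. -/
local notation "ℝ³" => EuclideanSpace ℝ (Fin 3)

/-! ## The hypotheses: a forward-anchored family of exact fractional Navier–Stokes solutions -/

section Family

/-- **The data glued in De Rosa's §5.2**: an exponent `γ > 0` and a viscosity `ν`, a final time
`T > 0`, a scale `τ > 0` with `nτ ≤ T < (n+1)τ`, a smooth solution `(v_ℓ, p_ℓ, R̊_ℓ)` of the
fractional Navier–Stokes–Reynolds system `∂ₜv + div(v ⊗ v) + ∇p + ν(-Δ)^γ v = div R̊`, `div v = 0`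
on `[0,T]` (the mollified triple of §5.1), and for every `j` with `jτ ≤ T` a smooth exact solution
`(u_j, p_j)` of the fractional Navier–Stokes equations (5.9) on
`S_j = [jτ - τ, jτ + τ] ∩ [0,T]` (`BDSV.glueInterval T τ j`) with `u_j = v_ℓ` at the **left
endpoint** `max(jτ - τ, 0)` of `S_j` — De Rosa's `vᵢ`, `i = j - 1`, solving (5.9) with
`vᵢ(·,tᵢ) = v_ℓ(·,tᵢ)`, `tᵢ = iτ_q`, "for `0 ≤ t - tᵢ ≤ 2τ_q`" (and `u₀ = v₀` once more, on
`[0, τ]`), in the indexing of the BDSV cut-offs (module docstring). The BDSV twin is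
`BDSV.IsGlueFamily` (exact Euler solutions anchored at the centres `jτ`).
[cite: Derosa2018, §5.2 (5.9) and the partition of unity] -/
structure IsGlueFamily (γ ν T τ : ℝ) (n : ℕ) (vℓ : ℝ → 𝕋³ → ℝ³) (pℓ : ℝ → 𝕋³ → ℝ)
    (Rℓ : ℝ → 𝕋³ → Fin 3 → ℝ³) (v : ℕ → ℝ → 𝕋³ → ℝ³) (p : ℕ → ℝ → 𝕋³ → ℝ) : Prop where
  /-- Positive dissipation exponent. -/
  hγ : 0 < γ
  /-- Positive final time. -/
  hT : 0 < T
  /-- Positive scale. -/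
  hτ : 0 < τ
  /-- `n = ⌊T/τ⌋`: `nτ ≤ T`. -/
  hn : (n : ℝ) * τ ≤ T
  /-- `n = ⌊T/τ⌋`: `T < (n+1)τ`. -/
  hn' : T < ((n : ℝ) + 1) * τ
  /-- The mollified triple solves the fractional NSR system on `[0,T]`. -/
  nsr : Torus.IsFracNSReynoldsOn (Icc 0 T) γ ν vℓ pℓ Rℓ
  /-- The exact solutions of the fractional Navier–Stokes equations on their life spans. -/
  exact : ∀ i : ℕ, (i : ℝ) * τ ≤ T →
    Torus.IsFracNSReynoldsOn (glueInterval T τ i) γ ν (v i) (p i) (fun _ _ _ => 0)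
  /-- The forward anchoring `u_j(max(jτ - τ, 0)) = v_ℓ(max(jτ - τ, 0))`. -/
  anchor : ∀ i : ℕ, (i : ℝ) * τ ≤ T → v i (max ((i : ℝ) * τ - τ) 0) = vℓ (max ((i : ℝ) * τ - τ) 0)

variable {γ ν T τ : ℝ} {n : ℕ} {vℓ : ℝ → 𝕋³ → ℝ³} {pℓ : ℝ → 𝕋³ → ℝ} {Rℓ : ℝ → 𝕋³ → Fin 3 → ℝ³}
  {v : ℕ → ℝ → 𝕋³ → ℝ³} {p : ℕ → ℝ → 𝕋³ → ℝ}
  (h : IsGlueFamily γ ν T τ n vℓ pℓ Rℓ v p)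
include h

/-! ### The time grid -/

/-- **The time grid of a De Rosa glue family is that of a BDSV glue family** (of the zero
solution, which is an exact Euler solution anchored everywhere): this transports the cut-off
bookkeeping of `OnsagerBDSVGluedTriple.lean` (which of the `χ_k`, `θ_k'`, `θ_k(1-θ_k)` are active
on `[t_i, t_i + τ]`, admissibility of the cut-offs) verbatim. [folklore] -/
theorem IsGlueFamily.grid :
    BDSV.IsGlueFamily T τ n (fun _ _ => 0) (fun _ _ => 0) (fun _ _ _ => 0) (fun _ _ _ => 0) (fun _ _ _ => 0) where
  hT := h.hT
  hτ := h.hτ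
  hn := h.hn
  hn' := h.hn'
  er := Torus.isEulerReynoldsOn_zero _
  exact _ _ := isExactEulerOn_zero _
  anchor _ _ := rfl

/-- Anchors up to `n` lie in `[0,T]`. [folklore] -/
theorem IsGlueFamily.anchor_le {i : ℕ} (hi : i ≤ n) : (i : ℝ) * τ ≤ T :=
  h.grid.anchor_le hi

/-- For `i < n`, `t_i + τ ≤ T`. [folklore] -/
theorem IsGlueFamily.anchor_add_le {i : ℕ} (hi : i < n) : (i : ℝ) * τ + τ ≤ T :=
  h.grid.anchor_add_le hi

/-- `[t_i, t_i + τ] ∩ [0,T] ⊆ S_i`. [folklore] -/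
theorem IsGlueFamily.Icc_inter_subset_glueInterval (i : ℕ) :
    Icc ((i : ℝ) * τ) ((i : ℝ) * τ + τ) ∩ Icc 0 T ⊆ glueInterval T τ i :=
  h.grid.Icc_inter_subset_glueInterval i

/-- `[t_i, t_i + τ] ∩ [0,T] ⊆ S_{i+1}`. [folklore] -/
theorem IsGlueFamily.Icc_inter_subset_glueInterval_succ (i : ℕ) :
    Icc ((i : ℝ) * τ) ((i : ℝ) * τ + τ) ∩ Icc 0 T ⊆ glueInterval T τ (i + 1) :=
  h.grid.Icc_inter_subset_glueInterval_succ i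

/-- Every `t ∈ [0,T]` lies in `[t_i, t_i + τ]` for some `i ≤ n`. [folklore] -/
theorem IsGlueFamily.exists_anchor {t : ℝ} (ht : t ∈ Icc 0 T) :
    ∃ i : ℕ, i ≤ n ∧ t ∈ Icc ((i : ℝ) * τ) ((i : ℝ) * τ + τ) :=
  h.grid.exists_anchor ht

/-- For `k < n`, `[t_k, t_k + τ]` lies in both life spans `S_k`, `S_{k+1}`. [folklore] -/
theorem IsGlueFamily.Icc_subset_glueInterval {k : ℕ} (hk : k < n) :
    Icc ((k : ℝ) * τ) ((k : ℝ) * τ + τ) ⊆ glueInterval T τ k ∧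
      Icc ((k : ℝ) * τ) ((k : ℝ) * τ + τ) ⊆ glueInterval T τ (k + 1) :=
  h.grid.Icc_subset_glueInterval hk

/-- The left endpoint `max(jτ - τ, 0)` of `S_j` lies in `S_j` (`jτ ≤ T`). [folklore] -/
theorem IsGlueFamily.leftAnchor_mem {i : ℕ} (hiT : (i : ℝ) * τ ≤ T) :
    max ((i : ℝ) * τ - τ) 0 ∈ glueInterval T τ i := by
  rw [glueInterval_eq_Icc]
  refine ⟨le_rfl, le_min ?_ ?_⟩
  · exact max_le (by linarith [h.hτ]) (by have := h.hτ.le; positivity)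
  · exact max_le (by linarith [h.hτ]) h.hT.le

/-! ### Smoothness of the building blocks -/

/-- The exact solutions are jointly smooth on their life spans (as closed intervals). [folklore] -/
theorem IsGlueFamily.smooth_v {i : ℕ} (hi : i ≤ n) :
    FunctionSpaces.Torus.IsSmoothSpaceTimeOn (Icc (max ((i : ℝ) * τ - τ) 0) (min ((i : ℝ) * τ + τ) T)) (v i) := by
  rw [← glueInterval_eq_Icc T τ i]
  exact (h.exact i (h.anchor_le hi)).smooth_velocity

/-- The pressures are jointly smooth on the life spans. [folklore] -/
theorem IsGlueFamily.smooth_p {i : ℕ} (hi : i ≤ n) :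
    FunctionSpaces.Torus.IsSmoothSpaceTimeOn (Icc (max ((i : ℝ) * τ - τ) 0) (min ((i : ℝ) * τ + τ) T)) (p i) := by
  rw [← glueInterval_eq_Icc T τ i]
  exact (h.exact i (h.anchor_le hi)).smooth_pressure

/-- The exact solutions are smooth at the times of their life spans. [folklore] -/
theorem IsGlueFamily.isSmooth_v {i : ℕ} (hi : i ≤ n) {t : ℝ} (ht : t ∈ glueInterval T τ i) :
    FunctionSpaces.Torus.IsSmooth (v i t) :=
  (h.exact i (h.anchor_le hi)).smooth_velocity.isSmooth_slice ht

/-- The mollified velocity is smooth at the times of `[0,T]`. [folklore] -/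
theorem IsGlueFamily.isSmooth_vℓ {t : ℝ} (ht : t ∈ Icc 0 T) : FunctionSpaces.Torus.IsSmooth (vℓ t) :=
  h.nsr.smooth_velocity.isSmooth_slice ht

/-- The exact solutions are divergence free at the times of their life spans. [folklore] -/
theorem IsGlueFamily.isDivFree_v {i : ℕ} (hi : i ≤ n) {t : ℝ} (ht : t ∈ glueInterval T τ i) :
    FunctionSpaces.Torus.IsDivFree (v i t) :=
  (h.exact i (h.anchor_le hi)).divFree t ht

/-- For `k < n` the difference `w_k = u_k - u_{k+1}` is jointly smooth on `[t_k, t_k + τ]`. [folklore] -/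
theorem IsGlueFamily.smooth_velDiff {k : ℕ} (hk : k < n) :
    FunctionSpaces.Torus.IsSmoothSpaceTimeOn (Icc ((k : ℝ) * τ) ((k : ℝ) * τ + τ)) (velDiff v k) := by
  obtain ⟨h1, h2⟩ := h.Icc_subset_glueInterval hk
  exact ((h.exact k (h.anchor_le hk.le)).smooth_velocity.mono h1).sub
    ((h.exact (k + 1) (h.anchor_le (Nat.succ_le_of_lt hk))).smooth_velocity.mono h2)

/-- For `k < n`, `ℛ(w_k)` is jointly smooth on `[t_k, t_k + τ]`. [folklore] -/
theorem IsGlueFamily.smooth_antidivergence {k : ℕ} (hk : k < n) :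
    FunctionSpaces.Torus.IsSmoothSpaceTimeOn (Icc ((k : ℝ) * τ) ((k : ℝ) * τ + τ)) (fun t => Torus.antidivergence (velDiff v k t)) := by
  have hint : (interior (Icc ((k : ℝ) * τ) ((k : ℝ) * τ + τ))).Nonempty := by
    rw [interior_Icc]; exact nonempty_Ioo.2 (by linarith [h.hτ])
  exact (h.smooth_velDiff hk).antidivergence (convex_Icc _ _) hint

/-- For `k < n`, `w_k ⊗̊ w_k` is jointly smooth on `[t_k, t_k + τ]`. [folklore] -/
theorem IsGlueFamily.smooth_tracelessSq {k : ℕ} (hk : k < n) :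
    FunctionSpaces.Torus.IsSmoothSpaceTimeOn (Icc ((k : ℝ) * τ) ((k : ℝ) * τ + τ)) (fun t => Torus.tracelessSq (velDiff v k t)) := by
  have hw := h.smooth_velDiff hk
  have hcomp : ∀ j : Fin 3, ContDiffOn ℝ ∞ (fun z : ℝ × EuclideanSpace ℝ (Fin 3) =>
      FunctionSpaces.Torus.stLift (fun t x => Torus.tracelessSq (velDiff v k t) x j) z) (Icc ((k : ℝ) * τ) ((k : ℝ) * τ + τ) ×ˢ univ) := by
    intro j
    have e : (fun z : ℝ × EuclideanSpace ℝ (Fin 3) => FunctionSpaces.Torus.stLift (fun t x => Torus.tracelessSq (velDiff v k t) x j) z) =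
        fun z => (FunctionSpaces.Torus.stLift (velDiff v k) z) j • FunctionSpaces.Torus.stLift (velDiff v k) z -
          (‖FunctionSpaces.Torus.stLift (velDiff v k) z‖ ^ 2 / Fintype.card (Fin 3)) • EuclideanSpace.single j (1 : ℝ) := by
      funext z
      simp [FunctionSpaces.Torus.stLift, Torus.tracelessSq]
    rw [e]
    have hj : ContDiffOn ℝ ∞ (fun z => (FunctionSpaces.Torus.stLift (velDiff v k) z) j) (Icc ((k : ℝ) * τ) ((k : ℝ) * τ + τ) ×ˢ univ) :=
      hw.apply j
    exact (hj.smul hw).sub (((hw.norm_sq ℝ).div_const _).smul contDiffOn_const)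
  unfold FunctionSpaces.Torus.IsSmoothSpaceTimeOn
  exact contDiffOn_pi.2 hcomp

/-- For `k < n`, `|w_k|²/3` is jointly smooth on `[t_k, t_k + τ]`. [folklore] -/
theorem IsGlueFamily.smooth_sqThird {k : ℕ} (hk : k < n) :
    FunctionSpaces.Torus.IsSmoothSpaceTimeOn (Icc ((k : ℝ) * τ) ((k : ℝ) * τ + τ)) (sqThird (velDiff v k)) :=
  ((h.smooth_velDiff hk).norm_sq ℝ).div_const _

/-- For `k < n`, `|w_k|²/3 - ∫|w_k|²/3` is jointly smooth on `[t_k, t_k + τ]`. [folklore] -/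
theorem IsGlueFamily.smooth_sqThird_sub {k : ℕ} (hk : k < n) :
    FunctionSpaces.Torus.IsSmoothSpaceTimeOn (Icc ((k : ℝ) * τ) ((k : ℝ) * τ + τ))
      (fun t x => sqThird (velDiff v k) t x - ∫ y, sqThird (velDiff v k) t y) :=
  (h.smooth_sqThird hk).sub ((h.smooth_sqThird hk).integral_const (uniqueDiffOn_Icc (by linarith [h.hτ])) (convex_Icc _ _))

/-! ### The cut-offs are admissible (from the grid) -/

/-- The velocity/pressure cut-off `χ_k` is admissible for the life span `S_k` relative to `[0,T]`. [folklore] -/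
theorem IsGlueFamily.isTimeCutoff_glueCutoff {k : ℕ} (hk : k ≤ n) :
    Torus.IsTimeCutoff (Icc 0 T) (max ((k : ℝ) * τ - τ) 0) (min ((k : ℝ) * τ + τ) T) (glueCutoff τ n k) :=
  h.grid.isTimeCutoff_glueCutoff hk

/-- The step derivative `θ_k'` (`k < n`) is admissible for `[t_k, t_k + τ]` relative to `[0,T]`. [folklore] -/
theorem IsGlueFamily.isTimeCutoff_stepDeriv {k : ℕ} (hk : k < n) :
    Torus.IsTimeCutoff (Icc 0 T) ((k : ℝ) * τ) ((k : ℝ) * τ + τ) (stepDeriv τ n k) :=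
  h.grid.isTimeCutoff_stepDeriv hk

/-- The transition weight `θ_k(1-θ_k)` (`k < n`) is admissible for `[t_k, t_k + τ]`. [folklore] -/
theorem IsGlueFamily.isTimeCutoff_stepWeight {k : ℕ} (hk : k < n) :
    Torus.IsTimeCutoff (Icc 0 T) ((k : ℝ) * τ) ((k : ℝ) * τ + τ) (stepWeight τ n k) :=
  h.grid.isTimeCutoff_stepWeight hk

/-! ### Smoothness of the glued fields on `[0,T]` -/

/-- **The glued velocity is jointly smooth on `[0,T] × 𝕋³`.** [cite: Derosa2018, §5.2 (the glued triple)] -/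
theorem IsGlueFamily.smooth_gluedVel : FunctionSpaces.Torus.IsSmoothSpaceTimeOn (Icc 0 T) (gluedVel τ n v) :=
  FunctionSpaces.Torus.IsSmoothSpaceTimeOn.sum fun _ hk =>
    (h.isTimeCutoff_glueCutoff (Nat.lt_succ_iff.1 (Finset.mem_range.1 hk))).isSmoothSpaceTimeOn_smul
      (h.smooth_v (Nat.lt_succ_iff.1 (Finset.mem_range.1 hk)))

/-- **The glued pressure is jointly smooth on `[0,T] × 𝕋³`.** [cite: Derosa2018, §5.2 (the glued triple)] -/
theorem IsGlueFamily.smooth_gluedPres : FunctionSpaces.Torus.IsSmoothSpaceTimeOn (Icc 0 T) (gluedPres τ n v p) := by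
  refine (FunctionSpaces.Torus.IsSmoothSpaceTimeOn.sum fun k hk => ?_).add (FunctionSpaces.Torus.IsSmoothSpaceTimeOn.sum fun k hk => ?_)
  · have hk' := Nat.lt_succ_iff.1 (Finset.mem_range.1 hk)
    have := (h.isTimeCutoff_glueCutoff hk').isSmoothSpaceTimeOn_smul (h.smooth_p hk')
    simpa only [smul_eq_mul] using this
  · have hk' := Finset.mem_range.1 hk
    have := (h.isTimeCutoff_stepWeight hk').isSmoothSpaceTimeOn_smul (h.smooth_sqThird_sub hk')
    simpa only [smul_eq_mul] using this

/-- **The glued stress is jointly smooth on `[0,T] × 𝕋³`** ("`R̊̄_q` is a smooth … 2-tensor",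
De Rosa p. 13). [cite: Derosa2018, §5.2 (the glued triple, first bullet)] -/
theorem IsGlueFamily.smooth_gluedStress : FunctionSpaces.Torus.IsSmoothSpaceTimeOn (Icc 0 T) (gluedStress τ n v) := by
  have hsum : FunctionSpaces.Torus.IsSmoothSpaceTimeOn (Icc 0 T) (fun t x => ∑ k ∈ Finset.range n,
      (stepDeriv τ n k t • Torus.antidivergence (velDiff v k t) x -
        stepWeight τ n k t • Torus.tracelessSq (velDiff v k t) x)) := by
    refine FunctionSpaces.Torus.IsSmoothSpaceTimeOn.sum fun k hk => ?_
    have hk' := Finset.mem_range.1 hk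
    exact ((h.isTimeCutoff_stepDeriv hk').isSmoothSpaceTimeOn_smul (h.smooth_antidivergence hk')).sub
      ((h.isTimeCutoff_stepWeight hk').isSmoothSpaceTimeOn_smul (h.smooth_tracelessSq hk'))
  refine ContDiffOn.congr hsum fun q _ => ?_
  funext j
  simp [gluedStress, FunctionSpaces.Torus.stLift, Finset.sum_apply]

/-! ### Which cut-offs are active on `[t_i, t_i + τ]` (from the grid) -/

section Active

variable {i k : ℕ} {t : ℝ}

/-- On `[t_i, t_i + τ]` the cut-offs `χ_k`, `k ∉ {i, i+1}`, vanish together with their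
derivatives. [folklore] -/
theorem IsGlueFamily.glueCutoff_inactive (hin : i ≤ n) (hki : k ≠ i) (hki' : k ≠ i + 1)
    (ht : t ∈ Icc ((i : ℝ) * τ) ((i : ℝ) * τ + τ)) :
    glueCutoff τ n k t = 0 ∧ deriv (glueCutoff τ n k) t = 0 :=
  h.grid.glueCutoff_inactive hin hki hki' ht

/-- Values and derivatives of the two active cut-offs on `[t_i, t_i + τ]`:
`χ_i = θ`, `χ_i' = θ'`, and for `i < n`: `χ_{i+1} = 1 - θ`, `χ_{i+1}' = -θ'`, `θ = upperStep i`. [folklore] -/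
theorem IsGlueFamily.glueCutoff_active (hin : i ≤ n) (ht : t ∈ Icc ((i : ℝ) * τ) ((i : ℝ) * τ + τ)) :
    glueCutoff τ n i t = upperStep τ n i t ∧ deriv (glueCutoff τ n i) t = stepDeriv τ n i t ∧
      (i < n → glueCutoff τ n (i + 1) t = 1 - upperStep τ n i t ∧
        deriv (glueCutoff τ n (i + 1)) t = -stepDeriv τ n i t) :=
  h.grid.glueCutoff_active hin ht

/-- On `[t_i, t_i + τ]` the step derivatives and weights of the other indices `k < n`, `k ≠ i`,
vanish (the transition windows are disjoint). [folklore] -/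
theorem IsGlueFamily.step_inactive (hkn : k < n) (hki : k ≠ i) (ht : t ∈ Icc ((i : ℝ) * τ) ((i : ℝ) * τ + τ)) :
    stepDeriv τ n k t = 0 ∧ stepWeight τ n k t = 0 :=
  h.grid.step_inactive hkn hki ht

end Active

/-! ### The glued fields at a time of `[t_i, t_i + τ]` -/

section LocalFormulas

variable {i : ℕ} {t : ℝ}

/-- **`v̄ = θ u_i + (1-θ) u_{i+1}` on `[t_i, t_i + τ]`**, `θ = upperStep i` (for `i = n`, `θ = 1`
and `v̄ = u_n`) (De Rosa p. 13: "if `t ∈ Iᵢ` then `χᵢ + χᵢ₊₁ = 1` and `χⱼ = 0` for `j ≠ i, i+1`,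
therefore `v̄_q = χᵢvᵢ + (1-χᵢ)vᵢ₊₁`"; on `Jᵢ`, `v̄_q = vᵢ`). [cite: Derosa2018, §5.2 (p. 13)] -/
theorem IsGlueFamily.gluedVel_apply (hin : i ≤ n) (ht : t ∈ Icc ((i : ℝ) * τ) ((i : ℝ) * τ + τ)) (x : 𝕋³) :
    gluedVel τ n v t x = upperStep τ n i t • v i t x + (1 - upperStep τ n i t) • v (i + 1) t x := by
  obtain ⟨hci, -, hsucc⟩ := h.glueCutoff_active hin ht
  unfold gluedVel
  rw [sum_range_succ_collapse hin (fun k => glueCutoff τ n k t • v k t x) fun k hk hk1 hk2 => by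
    rw [(h.glueCutoff_inactive hin hk1 hk2 ht).1, zero_smul]]
  rcases lt_or_eq_of_le hin with hi | rfl
  · rw [if_pos hi, hci, (hsucc hi).1]
  · rw [if_neg (lt_irrefl _), hci, upperStep_of_le le_rfl, sub_self, zero_smul]

/-- For `i = n`: `v̄(t) = u_n(t)` on `[t_n, T]`. [cite: Derosa2018, §5.2 (p. 13)] -/
theorem IsGlueFamily.gluedVel_apply_last (ht : t ∈ Icc ((n : ℝ) * τ) ((n : ℝ) * τ + τ)) (x : 𝕋³) :
    gluedVel τ n v t x = v n t x := by
  rw [h.gluedVel_apply le_rfl ht x, upperStep_of_le le_rfl, one_smul, sub_self, zero_smul, add_zero]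

/-- **`R̊̄ = θ' ℛ(w_i) - θ(1-θ) w_i ⊗̊ w_i` on `[t_i, t_i + τ]`** (`i < n`), and `R̊̄ = 0` there if
`i = n` (De Rosa p. 13). [cite: Derosa2018, §5.2 (definition of `R̊̄_q`)] -/
theorem IsGlueFamily.gluedStress_apply (ht : t ∈ Icc ((i : ℝ) * τ) ((i : ℝ) * τ + τ)) (x : 𝕋³) (j : Fin 3) :
    gluedStress τ n v t x j = if i < n then
      stepDeriv τ n i t • Torus.antidivergence (velDiff v i t) x j -
        stepWeight τ n i t • Torus.tracelessSq (velDiff v i t) x j else 0 := by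
  unfold gluedStress
  exact sum_range_collapse (fun k => stepDeriv τ n k t • Torus.antidivergence (velDiff v k t) x j -
      stepWeight τ n k t • Torus.tracelessSq (velDiff v k t) x j) fun k hk hki => by
    obtain ⟨h1, h2⟩ := h.step_inactive (Finset.mem_range.1 hk) hki ht
    rw [h1, h2, zero_smul, zero_smul, sub_zero]

/-- **The glued pressure on `[t_i, t_i + τ]`**: `p̄ = θ p_i + (1-θ) p_{i+1} + θ(1-θ)(q_i - ∫q_i)`
for `i < n` (and `p̄ = p_n` for `i = n`). [cite: Derosa2018, §5.2 (definition of `p̄_q`)] -/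
theorem IsGlueFamily.gluedPres_apply (hin : i ≤ n) (ht : t ∈ Icc ((i : ℝ) * τ) ((i : ℝ) * τ + τ)) (x : 𝕋³) :
    gluedPres τ n v p t x = upperStep τ n i t * p i t x + (1 - upperStep τ n i t) * p (i + 1) t x +
      stepWeight τ n i t * (sqThird (velDiff v i) t x - ∫ y, sqThird (velDiff v i) t y) := by
  obtain ⟨hci, -, hsucc⟩ := h.glueCutoff_active hin ht
  unfold gluedPres
  rw [sum_range_succ_collapse hin (fun k => glueCutoff τ n k t * p k t x) fun k hk hk1 hk2 => by
      rw [(h.glueCutoff_inactive hin hk1 hk2 ht).1, zero_mul],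
    sum_range_collapse (fun k => stepWeight τ n k t * (sqThird (velDiff v k) t x - ∫ y, sqThird (velDiff v k) t y))
      fun k hk hki => by rw [(h.step_inactive (Finset.mem_range.1 hk) hki ht).2, zero_mul]]
  rcases lt_or_eq_of_le hin with hi | rfl
  · rw [if_pos hi, if_pos hi, hci, (hsucc hi).1]
  · rw [if_neg (lt_irrefl _), if_neg (lt_irrefl _), hci, upperStep_of_le le_rfl, stepWeight_of_le le_rfl]
    ring

/-- **The time derivative of `v̄` within `[0,T]`** at a time of `[t_i, t_i + τ]`:
`∂ₜv̄ = θ'u_i + θ∂ₜu_i - θ'u_{i+1} + (1-θ)∂ₜu_{i+1}`, the derivatives of the exact solutions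
being taken within their life spans. [cite: Derosa2018, §5.2 (p. 13)] -/
theorem IsGlueFamily.timeDerivWithin_gluedVel (hin : i ≤ n) (ht : t ∈ Icc ((i : ℝ) * τ) ((i : ℝ) * τ + τ))
    (htT : t ∈ Icc 0 T) (x : 𝕋³) :
    FunctionSpaces.Torus.timeDerivWithin (Icc 0 T) (gluedVel τ n v) t x =
      stepDeriv τ n i t • v i t x +
        upperStep τ n i t • FunctionSpaces.Torus.timeDerivWithin
          (Icc (max ((i : ℝ) * τ - τ) 0) (min ((i : ℝ) * τ + τ) T)) (v i) t x +
      (-(stepDeriv τ n i t) • v (i + 1) t x +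
        (1 - upperStep τ n i t) • FunctionSpaces.Torus.timeDerivWithin
          (Icc (max (((i + 1 : ℕ) : ℝ) * τ - τ) 0) (min (((i + 1 : ℕ) : ℝ) * τ + τ) T)) (v (i + 1)) t x) := by
  obtain ⟨hci, hci', hsucc⟩ := h.glueCutoff_active hin ht
  -- term-wise derivatives
  set D : ℕ → ℝ³ := fun k => FunctionSpaces.Torus.timeDerivWithin
    (Icc (max ((k : ℝ) * τ - τ) 0) (min ((k : ℝ) * τ + τ) T)) (v k) t x with hD
  have hsum : HasDerivWithinAt (fun s => ∑ k ∈ Finset.range (n + 1), glueCutoff τ n k s • v k s x)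
      (∑ k ∈ Finset.range (n + 1), (deriv (glueCutoff τ n k) t • v k t x + glueCutoff τ n k t • D k)) (Icc 0 T) t := by
    refine HasDerivWithinAt.fun_sum fun k hk => ?_
    have hk' := Nat.lt_succ_iff.1 (Finset.mem_range.1 hk)
    rcases Nat.lt_or_ge n k with hnk | hnk
    · exact absurd hk' (not_le.2 hnk)
    · exact (h.isTimeCutoff_glueCutoff hk').hasDerivWithinAt_smul (h.smooth_v hk') htT x
  have hcoll : ∑ k ∈ Finset.range (n + 1), (deriv (glueCutoff τ n k) t • v k t x + glueCutoff τ n k t • D k) =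
      stepDeriv τ n i t • v i t x + upperStep τ n i t • D i +
        (-(stepDeriv τ n i t) • v (i + 1) t x + (1 - upperStep τ n i t) • D (i + 1)) := by
    rw [sum_range_succ_collapse hin (fun k => deriv (glueCutoff τ n k) t • v k t x + glueCutoff τ n k t • D k)
      fun k hk hk1 hk2 => by
        obtain ⟨h0, h0'⟩ := h.glueCutoff_inactive hin hk1 hk2 ht
        rw [h0, h0', zero_smul, zero_smul, add_zero]]
    rcases lt_or_eq_of_le hin with hi | rfl
    · rw [if_pos hi, hci, hci', (hsucc hi).1, (hsucc hi).2]
    · rw [if_neg (lt_irrefl _), hci, hci', upperStep_of_le le_rfl, stepDeriv_of_le le_rfl]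
      simp
  rw [hcoll] at hsum
  exact hsum.derivWithin (uniqueDiffOn_Icc h.hT t htT)

/-- **`v̄(·,0) = v_ℓ(·,0)`** (De Rosa: `v̄_q = v₀` on `J₀ ∋ 0` and `v₀(·,t₀) = v_ℓ(·,0)`; here
`χ₀(0) = 1` and `u₀(0) = v_ℓ(0)`), the time-zero clause of `DeRosa.gluingStage`. [cite: Derosa2018, §5.2 (p. 13) and Prop. 4.1 (time zero)] -/
theorem IsGlueFamily.gluedVel_zero : gluedVel τ n v 0 = vℓ 0 := by
  have ht : (0 : ℝ) ∈ Icc (((0 : ℕ) : ℝ) * τ) (((0 : ℕ) : ℝ) * τ + τ) := by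
    simp [h.hτ.le]
  have hθ : upperStep τ n 0 0 = 1 := by
    rcases Nat.eq_zero_or_pos n with hn0 | hn0
    · exact upperStep_of_le (by omega) τ 0
    · rw [upperStep_of_lt hn0]
      exact glueStep_of_le h.hτ (by simp; linarith [h.hτ])
  have ha := h.anchor 0 (by simpa using h.hT.le)
  have e0 : max (((0 : ℕ) : ℝ) * τ - τ) 0 = 0 := max_eq_right (by simp [h.hτ.le])
  rw [e0] at ha
  funext x
  rw [h.gluedVel_apply (Nat.zero_le n) ht x, hθ, one_smul, sub_self, zero_smul, add_zero, ha]

end LocalFormulas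

/-! ### The fractional Navier–Stokes–Reynolds system of the glued triple -/

section FracNSReynolds

variable {i : ℕ} {t : ℝ}

/-- `t ∈ [t_i, t_i+τ] ∩ [0,T]` lies in the closed life span of `u_i` (`i ≤ n`). [folklore] -/
theorem IsGlueFamily.mem_span (ht : t ∈ Icc ((i : ℝ) * τ) ((i : ℝ) * τ + τ)) (htT : t ∈ Icc 0 T) :
    t ∈ Icc (max ((i : ℝ) * τ - τ) 0) (min ((i : ℝ) * τ + τ) T) := by
  rw [← glueInterval_eq_Icc T τ i]
  exact h.Icc_inter_subset_glueInterval i ⟨ht, htT⟩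

/-- `t ∈ [t_i, t_i+τ] ∩ [0,T]` lies in the closed life span of `u_{i+1}`. [folklore] -/
theorem IsGlueFamily.mem_span_succ (ht : t ∈ Icc ((i : ℝ) * τ) ((i : ℝ) * τ + τ)) (htT : t ∈ Icc 0 T) :
    t ∈ Icc (max (((i + 1 : ℕ) : ℝ) * τ - τ) 0) (min (((i + 1 : ℕ) : ℝ) * τ + τ) T) := by
  rw [← glueInterval_eq_Icc T τ (i + 1)]
  exact h.Icc_inter_subset_glueInterval_succ i ⟨ht, htT⟩

/-- The fractional Navier–Stokes equations (5.9) of `u_i` at a time of its life span, with the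
time derivative within the closed life span and the zero stress simplified:
`∂ₜu_i + (u_i·∇)u_i + ∇p_i + ν(-Δ)^γ u_i = 0`. [cite: Derosa2018, §5.2 (5.9)] -/
theorem IsGlueFamily.fracNS (hin : i ≤ n) {s : ℝ} (hs : s ∈ Icc (max ((i : ℝ) * τ - τ) 0) (min ((i : ℝ) * τ + τ) T))
    (x : 𝕋³) :
    FunctionSpaces.Torus.timeDerivWithin (Icc (max ((i : ℝ) * τ - τ) 0) (min ((i : ℝ) * τ + τ) T)) (v i) s x +
        FunctionSpaces.Torus.convect (v i s) (v i s) x + FunctionSpaces.Torus.gradient (p i s) x +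
        ν • Torus.fracLaplacian γ (v i s) x = 0 := by
  have hex := h.exact i (h.anchor_le hin)
  have hs' : s ∈ glueInterval T τ i := by rwa [glueInterval_eq_Icc]
  have hm := hex.momentum s hs' x
  rw [glueInterval_eq_Icc] at hm
  rw [hm]
  exact Torus.tensorDivergence_zero x

/-- **Conservation of momentum along the family**: `∫ u_i(t) = ∫ v_ℓ(0)` on the life span of
`u_i` (exact solutions and the mollified triple conserve momentum, and `u_i = v_ℓ` at the left
endpoint of the life span). [cite: Derosa2018, §5.2 (5.22)] -/
theorem IsGlueFamily.integral_v_eq (hin : i ≤ n) {s : ℝ} (hs : s ∈ Icc (max ((i : ℝ) * τ - τ) 0) (min ((i : ℝ) * τ + τ) T)) :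
    ∫ x, v i s x = ∫ x, vℓ 0 x := by
  have hiT := h.anchor_le hin
  have hex := h.exact i hiT
  have hanchor : max ((i : ℝ) * τ - τ) 0 ∈ Icc (max ((i : ℝ) * τ - τ) 0) (min ((i : ℝ) * τ + τ) T) := by
    rw [← glueInterval_eq_Icc]
    exact h.leftAnchor_mem hiT
  have hexI : Torus.IsFracNSReynoldsOn (Icc (max ((i : ℝ) * τ - τ) 0) (min ((i : ℝ) * τ + τ) T)) γ ν (v i) (p i) (fun _ _ _ => 0) := by
    have := hex
    rwa [glueInterval_eq_Icc] at this
  have h0T : max ((i : ℝ) * τ - τ) 0 ∈ Icc 0 T :=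
    ⟨le_max_right _ _, max_le (by linarith [h.hτ]) h.hT.le⟩
  rw [hexI.integral_velocity_eq h.hγ hs hanchor, h.anchor i hiT,
    h.nsr.integral_velocity_eq h.hγ h0T ⟨le_rfl, h.hT.le⟩]

/-- **`w_i = u_i - u_{i+1}` has zero mean** on `[t_i, t_i + τ]`, `i < n` (so that `div ℛw_i = w_i`;
De Rosa p. 13: `ℛ` "when acting on vectors `f` with zero mean on `𝕋³` … has the property that
`ℛf` is symmetric and `div(ℛf) = f`"). [cite: Derosa2018, §5.2 (the operator `ℛ`, p. 13)] -/
theorem IsGlueFamily.integral_velDiff (hi : i < n) (ht : t ∈ Icc ((i : ℝ) * τ) ((i : ℝ) * τ + τ)) :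
    ∫ x, velDiff v i t x = 0 := by
  have htT : t ∈ Icc 0 T := ⟨le_trans (by have := h.hτ.le; positivity) ht.1, le_trans ht.2 (h.anchor_add_le hi)⟩
  have h1 := h.integral_v_eq hi.le (h.mem_span ht htT)
  have h2 := h.integral_v_eq (Nat.succ_le_of_lt hi) (h.mem_span_succ ht htT)
  have hv1 : FunctionSpaces.Torus.IsSmooth (v i t) := (h.smooth_v hi.le).isSmooth_slice (h.mem_span ht htT)
  have hv2 : FunctionSpaces.Torus.IsSmooth (v (i + 1) t) :=
    (h.smooth_v (Nat.succ_le_of_lt hi)).isSmooth_slice (h.mem_span_succ ht htT)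
  unfold velDiff
  rw [integral_sub hv1.integrable hv2.integrable, h1, h2, sub_self]

/-- **The momentum equation of the glued triple** at a time of `[t_i, t_i + τ]` (De Rosa p. 13:
`∂ₜv̄_q + div(v̄_q ⊗ v̄_q) + ∇p̄_q⁽¹⁾ + ν(-Δ)^γ v̄_q = ∂ₜχᵢ(vᵢ - vᵢ₊₁) - χᵢ(1-χᵢ) div((vᵢ - vᵢ₊₁) ⊗ (vᵢ - vᵢ₊₁))`
on `Iᵢ`, `= 0` on `Jᵢ`, matched by `div R̊̄_q - ∇p̄_q⁽²⁾`; the dissipative term is linear: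
`(-Δ)^γ(χᵢvᵢ + (1-χᵢ)vᵢ₊₁) = χᵢ(-Δ)^γvᵢ + (1-χᵢ)(-Δ)^γvᵢ₊₁`). [cite: Derosa2018, §5.2 (p. 13, second bullet)] -/
theorem IsGlueFamily.momentum (hin : i ≤ n) (ht : t ∈ Icc ((i : ℝ) * τ) ((i : ℝ) * τ + τ)) (htT : t ∈ Icc 0 T)
    (x : 𝕋³) :
    FunctionSpaces.Torus.timeDerivWithin (Icc 0 T) (gluedVel τ n v) t x +
          FunctionSpaces.Torus.convect (gluedVel τ n v t) (gluedVel τ n v t) x +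
        FunctionSpaces.Torus.gradient (gluedPres τ n v p t) x +
        ν • Torus.fracLaplacian γ (gluedVel τ n v t) x =
      Torus.tensorDivergence (gluedStress τ n v t) x := by
  have hγ0 : 0 ≤ γ := h.hγ.le
  have hti := h.mem_span ht htT
  have hA := h.fracNS hin hti x
  have hvA : FunctionSpaces.Torus.IsSmooth (v i t) := (h.smooth_v hin).isSmooth_slice hti
  have hpA : FunctionSpaces.Torus.IsSmooth (p i t) := (h.smooth_p hin).isSmooth_slice hti
  rcases lt_or_eq_of_le hin with hi | rfl
  · -- two active solutions
    have hti' := h.mem_span_succ ht htT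
    have hB := h.fracNS (Nat.succ_le_of_lt hi) hti' x
    have hvB : FunctionSpaces.Torus.IsSmooth (v (i + 1) t) := (h.smooth_v (Nat.succ_le_of_lt hi)).isSmooth_slice hti'
    have hpB : FunctionSpaces.Torus.IsSmooth (p (i + 1) t) := (h.smooth_p (Nat.succ_le_of_lt hi)).isSmooth_slice hti'
    -- abbreviations
    set c : ℝ := upperStep τ n i t with hc_def
    set c' : ℝ := stepDeriv τ n i t with hc'_def
    have hm : stepWeight τ n i t = c * (1 - c) := rfl
    set M : ℝ := ∫ y, sqThird (velDiff v i) t y with hM_def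
    -- the slices
    have hw : FunctionSpaces.Torus.IsSmooth (velDiff v i t) := hvA.sub hvB
    have hwdef : velDiff v i t = fun y => v i t y + (-1 : ℝ) • v (i + 1) t y := by
      funext y; simp [velDiff, sub_eq_add_neg]
    have hwdiv : FunctionSpaces.Torus.IsDivFree (velDiff v i t) := by
      rw [hwdef]
      exact IsDivFree.add (hvA.isContDiff (by simp)) ((hvB.smul (-1)).isContDiff (by simp))
        (h.isDivFree_v hin (by rw [glueInterval_eq_Icc]; exact hti))
        (Torus.isDivFree_const_smul (hvB.isContDiff (by simp))
          (h.isDivFree_v (Nat.succ_le_of_lt hi) (by rw [glueInterval_eq_Icc]; exact hti')) _)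
    have hq : FunctionSpaces.Torus.IsSmooth (sqThird (velDiff v i) t) := by
      have := hw.norm_sq.div_const (Fintype.card (Fin 3) : ℝ)
      exact this
    have hV : gluedVel τ n v t = fun y => c • v i t y + (1 - c) • v (i + 1) t y :=
      funext fun y => h.gluedVel_apply hin ht y
    have hPr : gluedPres τ n v p t = fun y => c * p i t y + ((1 - c) * p (i + 1) t y +
        (c * (1 - c)) * (sqThird (velDiff v i) t y + (-M))) := by
      funext y
      rw [h.gluedPres_apply hin ht y, hm]
      ring
    have hSt : gluedStress τ n v t = fun y j => c' • Torus.antidivergence (velDiff v i t) y j +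
        (-(c * (1 - c))) • Torus.tracelessSq (velDiff v i t) y j := by
      funext y j
      rw [h.gluedStress_apply ht y j, if_pos hi, hm, sub_eq_add_neg, neg_smul]
    -- regularity of the pieces
    have h1A : FunctionSpaces.Torus.IsContDiff 1 (v i t) := hvA.isContDiff (by simp)
    have h1B : FunctionSpaces.Torus.IsContDiff 1 (v (i + 1) t) := hvB.isContDiff (by simp)
    have h1cA : FunctionSpaces.Torus.IsContDiff 1 (fun y => c • v i t y) := (hvA.smul c).isContDiff (by simp)
    have h1cB : FunctionSpaces.Torus.IsContDiff 1 (fun y => (1 - c) • v (i + 1) t y) := (hvB.smul (1 - c)).isContDiff (by simp)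
    have h1pA : FunctionSpaces.Torus.IsContDiff 1 (p i t) := hpA.isContDiff (by simp)
    have h1pB : FunctionSpaces.Torus.IsContDiff 1 (p (i + 1) t) := hpB.isContDiff (by simp)
    have h1q : FunctionSpaces.Torus.IsContDiff 1 (sqThird (velDiff v i) t) := hq.isContDiff (by simp)
    have h1qM : FunctionSpaces.Torus.IsContDiff 1 (fun y => sqThird (velDiff v i) t y + (-M)) :=
      (hq.add (isSmooth_const _)).isContDiff (by simp)
    have h1a : FunctionSpaces.Torus.IsContDiff 1 (fun y => (c * (1 - c)) * (sqThird (velDiff v i) t y + (-M))) :=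
      ((hq.add (isSmooth_const _)).smul (c * (1 - c))).isContDiff (by simp)
    have h1b : FunctionSpaces.Torus.IsContDiff 1 (fun y => (1 - c) * p (i + 1) t y) := (hpB.smul (1 - c)).isContDiff (by simp)
    have h1ba : FunctionSpaces.Torus.IsContDiff 1 (fun y => (1 - c) * p (i + 1) t y +
        (c * (1 - c)) * (sqThird (velDiff v i) t y + (-M))) := h1b.add h1a
    have h1cpA : FunctionSpaces.Torus.IsContDiff 1 (fun y => c * p i t y) := (hpA.smul c).isContDiff (by simp)
    have hRA : FunctionSpaces.Torus.IsSmooth (Torus.antidivergence (velDiff v i t)) := Torus.isSmooth_antidivergence hw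
    have h1R : FunctionSpaces.Torus.IsContDiff 1 (fun y j => c' • Torus.antidivergence (velDiff v i t) y j) :=
      (hRA.smul c').isContDiff (by simp)
    have h1T : FunctionSpaces.Torus.IsContDiff 1 (fun y j => (-(c * (1 - c))) • Torus.tracelessSq (velDiff v i t) y j) :=
      (hw.tracelessSq.smul _).isContDiff (by simp)
    -- the operators on the slices
    have eConv : FunctionSpaces.Torus.convect (gluedVel τ n v t) (gluedVel τ n v t) x =
        c • (c • FunctionSpaces.Torus.convect (v i t) (v i t) x + (1 - c) • FunctionSpaces.Torus.convect (v i t) (v (i + 1) t) x) +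
          (1 - c) • (c • FunctionSpaces.Torus.convect (v (i + 1) t) (v i t) x +
            (1 - c) • FunctionSpaces.Torus.convect (v (i + 1) t) (v (i + 1) t) x) := by
      rw [hV, Torus.convect_add_left, Torus.convect_smul_left, Torus.convect_smul_left, Torus.convect_add_right _ h1cA h1cB,
        Torus.convect_add_right _ h1cA h1cB, Torus.convect_smul_right _ h1A, Torus.convect_smul_right _ h1B,
        Torus.convect_smul_right _ h1A, Torus.convect_smul_right _ h1B]
    have eConvW : FunctionSpaces.Torus.convect (velDiff v i t) (velDiff v i t) x =
        FunctionSpaces.Torus.convect (v i t) (v i t) x + (-1 : ℝ) • FunctionSpaces.Torus.convect (v i t) (v (i + 1) t) x +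
          (-1 : ℝ) • (FunctionSpaces.Torus.convect (v (i + 1) t) (v i t) x +
            (-1 : ℝ) • FunctionSpaces.Torus.convect (v (i + 1) t) (v (i + 1) t) x) := by
      have h1nB : FunctionSpaces.Torus.IsContDiff 1 (fun y => (-1 : ℝ) • v (i + 1) t y) := (hvB.smul (-1)).isContDiff (by simp)
      rw [hwdef, Torus.convect_add_left, Torus.convect_smul_left, Torus.convect_add_right _ h1A h1nB, Torus.convect_add_right _ h1A h1nB,
        Torus.convect_smul_right _ h1B, Torus.convect_smul_right _ h1B]
    have eGrad : FunctionSpaces.Torus.gradient (gluedPres τ n v p t) x =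
        c • FunctionSpaces.Torus.gradient (p i t) x + ((1 - c) • FunctionSpaces.Torus.gradient (p (i + 1) t) x +
          (c * (1 - c)) • FunctionSpaces.Torus.gradient (sqThird (velDiff v i) t) x) := by
      rw [hPr, Torus.gradient_add_apply h1cpA h1ba, Torus.gradient_add_apply h1b h1a, Torus.gradient_const_mul_apply h1pA,
        Torus.gradient_const_mul_apply h1pB, Torus.gradient_const_mul_apply h1qM, Torus.gradient_add_apply h1q (isContDiff_const _),
        Torus.gradient_const, add_zero]
    have eDiv : Torus.tensorDivergence (gluedStress τ n v t) x =
        c' • velDiff v i t x + (-(c * (1 - c))) • (FunctionSpaces.Torus.convect (velDiff v i t) (velDiff v i t) x -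
          FunctionSpaces.Torus.gradient (sqThird (velDiff v i) t) x) := by
      rw [hSt, Torus.tensorDivergence_add_apply h1R h1T, Torus.tensorDivergence_const_smul_apply (hRA.isContDiff (by simp)),
        Torus.tensorDivergence_const_smul_apply (hw.tracelessSq.isContDiff (by simp)),
        Torus.tensorDivergence_antidivergence (by simp) hw, h.integral_velDiff hi ht, sub_zero,
        Torus.tensorDivergence_tracelessSq hw hwdiv]
      rfl
    have eLap : Torus.fracLaplacian γ (gluedVel τ n v t) x =
        c • Torus.fracLaplacian γ (v i t) x + (1 - c) • Torus.fracLaplacian γ (v (i + 1) t) x := by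
      rw [hV]
      have hadd := Torus.fracLaplacian_add hγ0 (hvA.smul c) (hvB.smul (1 - c))
      have e1 : (fun y => c • v i t y + (1 - c) • v (i + 1) t y) = fun y => (c • v i t) y + ((1 - c) • v (i + 1) t) y := rfl
      rw [e1, hadd]
      simp only [Torus.fracLaplacian_const_smul, Pi.smul_apply]
    have eW : velDiff v i t x = v i t x - v (i + 1) t x := rfl
    rw [h.timeDerivWithin_gluedVel hin ht htT x, eConv, eGrad, eDiv, eConvW, eW, eLap]
    -- linear algebra
    set DA := FunctionSpaces.Torus.timeDerivWithin (Icc (max ((i : ℝ) * τ - τ) 0) (min ((i : ℝ) * τ + τ) T)) (v i) t x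
    set DB := FunctionSpaces.Torus.timeDerivWithin
      (Icc (max (((i + 1 : ℕ) : ℝ) * τ - τ) 0) (min (((i + 1 : ℕ) : ℝ) * τ + τ) T)) (v (i + 1)) t x
    set CAA := FunctionSpaces.Torus.convect (v i t) (v i t) x
    set CAB := FunctionSpaces.Torus.convect (v i t) (v (i + 1) t) x
    set CBA := FunctionSpaces.Torus.convect (v (i + 1) t) (v i t) x
    set CBB := FunctionSpaces.Torus.convect (v (i + 1) t) (v (i + 1) t) x
    set GA := FunctionSpaces.Torus.gradient (p i t) x
    set GB := FunctionSpaces.Torus.gradient (p (i + 1) t) x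
    set GQ := FunctionSpaces.Torus.gradient (sqThird (velDiff v i) t) x
    set LA := Torus.fracLaplacian γ (v i t) x
    set LB := Torus.fracLaplacian γ (v (i + 1) t) x
    set A := v i t x
    set B := v (i + 1) t x
    -- `hA : DA + CAA + GA + ν • LA = 0`, `hB : DB + CBB + GB + ν • LB = 0`
    have key : c' • A + c • DA + (-c' • B + (1 - c) • DB) +
        (c • (c • CAA + (1 - c) • CAB) + (1 - c) • (c • CBA + (1 - c) • CBB)) +
        (c • GA + ((1 - c) • GB + (c * (1 - c)) • GQ)) + ν • (c • LA + (1 - c) • LB) -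
        (c' • (A - B) + (-(c * (1 - c))) • (CAA + (-1 : ℝ) • CAB + (-1 : ℝ) • (CBA + (-1 : ℝ) • CBB) - GQ)) =
        c • (DA + CAA + GA + ν • LA) + (1 - c) • (DB + CBB + GB + ν • LB) := by
      module
    rw [hA, hB, smul_zero, smul_zero, add_zero, sub_eq_zero] at key
    exact key
  · -- the last interval: `v̄ = uₙ`, `p̄ = pₙ`, `R̊̄ = 0`
    have hV : gluedVel τ i v t = v i t := funext fun y => h.gluedVel_apply_last ht y
    have hPr : gluedPres τ i v p t = p i t := by
      funext y
      rw [h.gluedPres_apply le_rfl ht y, upperStep_of_le le_rfl, stepWeight_of_le le_rfl]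
      ring
    have hSt : gluedStress τ i v t = fun _ _ => (0 : ℝ³) := by
      funext y j
      rw [h.gluedStress_apply ht y j, if_neg (lt_irrefl _)]
    have hD : FunctionSpaces.Torus.timeDerivWithin (Icc 0 T) (gluedVel τ i v) t x =
        FunctionSpaces.Torus.timeDerivWithin (Icc (max ((i : ℝ) * τ - τ) 0) (min ((i : ℝ) * τ + τ) T)) (v i) t x := by
      rw [h.timeDerivWithin_gluedVel le_rfl ht htT x, upperStep_of_le le_rfl, stepDeriv_of_le le_rfl]
      simp
    rw [hD, hV, hPr, hSt, hA]
    exact (Torus.tensorDivergence_zero x).symm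

/-- **The glued triple solves the fractional Navier–Stokes–Reynolds system on `[0,T] × 𝕋³`**
(De Rosa p. 13–14, the bullets: `R̊̄_q` is a smooth symmetric 2-tensor and
`∂ₜv̄_q + div(v̄_q ⊗ v̄_q) + ∇p̄_q + ν(-Δ)^γ v̄_q = div R̊̄_q`, `div v̄_q = 0` on `𝕋³ × [0,T]`).
[cite: Derosa2018, §5.2 (the glued triple, bullets on pp. 13–14)] -/
theorem IsGlueFamily.isFracNSReynoldsOn_glued :
    Torus.IsFracNSReynoldsOn (Icc 0 T) γ ν (gluedVel τ n v) (gluedPres τ n v p) (gluedStress τ n v) where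
  smooth_velocity := h.smooth_gluedVel
  smooth_pressure := h.smooth_gluedPres
  smooth_stress := h.smooth_gluedStress
  momentum t ht x := by
    obtain ⟨i, hin, hti⟩ := h.exists_anchor ht
    exact h.momentum hin hti ht x
  divFree t ht := by
    obtain ⟨i, hin, hti⟩ := h.exists_anchor ht
    have hsi := h.mem_span hti ht
    have hvA : FunctionSpaces.Torus.IsSmooth (v i t) := (h.smooth_v hin).isSmooth_slice hsi
    have hdA : FunctionSpaces.Torus.IsDivFree (v i t) := h.isDivFree_v hin (by rw [glueInterval_eq_Icc]; exact hsi)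
    rcases lt_or_eq_of_le hin with hi | rfl
    · have hsi' := h.mem_span_succ hti ht
      have hvB : FunctionSpaces.Torus.IsSmooth (v (i + 1) t) := (h.smooth_v (Nat.succ_le_of_lt hi)).isSmooth_slice hsi'
      have hdB : FunctionSpaces.Torus.IsDivFree (v (i + 1) t) :=
        h.isDivFree_v (Nat.succ_le_of_lt hi) (by rw [glueInterval_eq_Icc]; exact hsi')
      have hV : gluedVel τ n v t = fun y => upperStep τ n i t • v i t y + (1 - upperStep τ n i t) • v (i + 1) t y :=
        funext fun y => h.gluedVel_apply hin hti y
      rw [hV]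
      exact IsDivFree.add ((hvA.smul _).isContDiff (by simp)) ((hvB.smul _).isContDiff (by simp))
        (Torus.isDivFree_const_smul (hvA.isContDiff (by simp)) hdA _) (Torus.isDivFree_const_smul (hvB.isContDiff (by simp)) hdB _)
    · have hV : gluedVel τ i v t = v i t := funext fun y => h.gluedVel_apply_last hti y
      rw [hV]
      exact hdA
  symm t ht x j k := by
    obtain ⟨i, hin, hti⟩ := h.exists_anchor ht
    rw [h.gluedStress_apply hti, h.gluedStress_apply hti]
    split_ifs with hi
    · have hsi := h.mem_span hti ht
      have hsi' := h.mem_span_succ hti ht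
      have hw : FunctionSpaces.Torus.IsSmooth (velDiff v i t) :=
        ((h.smooth_v hin).isSmooth_slice hsi).sub ((h.smooth_v (Nat.succ_le_of_lt hi)).isSmooth_slice hsi')
      simp only [PiLp.sub_apply, PiLp.smul_apply, smul_eq_mul]
      rw [Torus.antidivergence_symm hw x j k, Torus.tracelessSq_symm (velDiff v i t) x j k]
    · rfl

/-- **The glued stress is trace free** ("`R̊̄_q` is a smooth symmetric and traceless 2-tensor",
De Rosa p. 13). [cite: Derosa2018, §5.2 (the glued triple, first bullet)] -/
theorem IsGlueFamily.traceFree_gluedStress {t : ℝ} (ht : t ∈ Icc 0 T) (x : 𝕋³) :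
    ∑ j : Fin 3, gluedStress τ n v t x j j = 0 := by
  obtain ⟨i, hin, hti⟩ := h.exists_anchor ht
  simp_rw [h.gluedStress_apply hti]
  split_ifs with hi
  · have hsi := h.mem_span hti ht
    have hsi' := h.mem_span_succ hti ht
    have hw : FunctionSpaces.Torus.IsSmooth (velDiff v i t) :=
      ((h.smooth_v hin).isSmooth_slice hsi).sub ((h.smooth_v (Nat.succ_le_of_lt hi)).isSmooth_slice hsi')
    simp only [PiLp.sub_apply, PiLp.smul_apply, smul_eq_mul, Finset.sum_sub_distrib, ← Finset.mul_sum,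
      Torus.antidivergence_trace (by simp) hw x, Torus.tracelessSq_traceFree (by simp) (velDiff v i t) x]
    ring
  · simp

/-- **The support property** `supp R̊̄_q ⊂ 𝕋³ × ⋃ᵢ Iᵢ`: the glued stress vanishes at every time of
`[0,T]` outside `⋃ₘ [t_m + τ/3, t_m + 2τ/3]` (`θ_m' = θ_m(1-θ_m) = 0` there), i.e.
`BDSV.SupportedOnGlueIntervals`, the support clause of `DeRosa.gluingStage`. [cite: Derosa2018, §5.2 (the glued triple, third bullet, p. 14)] -/
theorem IsGlueFamily.supportedOnGlueIntervals_gluedStress : SupportedOnGlueIntervals T τ (gluedStress τ n v) := by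
  intro t ht hnot x
  obtain ⟨i, hin, hti⟩ := h.exists_anchor ht
  funext j
  rw [h.gluedStress_apply hti x j]
  split_ifs with hi
  · have hout : t ≤ (i : ℝ) * τ + τ / 3 ∨ (i : ℝ) * τ + 2 * τ / 3 ≤ t := by
      by_contra hc
      push Not at hc
      exact hnot i ⟨by linarith [hc.1], by linarith [hc.2]⟩
    have e : upperStep τ n i = glueStep τ (i * τ) := funext fun s => upperStep_of_lt hi τ s
    have h1 : stepDeriv τ n i t = 0 := by
      unfold stepDeriv
      rw [e]
      exact deriv_glueStep_eq_zero h.hτ hout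
    have h2 : stepWeight τ n i t = 0 := by
      unfold stepWeight
      rw [upperStep_of_lt hi]
      exact glueStep_mul_one_sub_eq_zero h.hτ hout
    rw [h1, h2, zero_smul, zero_smul, sub_zero]
    rfl
  · rfl

end FracNSReynolds

end Family

end DeRosa

end Literature.Analysis.FluidPDE
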